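import Literature.NumberTheory.Automorphic.AutomorphicInductionCuspidalUnramified
import HarnessLib

/-!
# Cyclic automorphic induction, cuspidal case, at EVERY unramified place: the residue over the
# almost-everywhere fact (Henniart 2012, Thm. 5; proof file)

Topic `NumberTheory/Automorphic`; namespace `Literature.NumberTheory.Automorphic`.  A proof file
(theorems only: no definition, no named fact) next to `AutomorphicInductionCuspidalUnramified`,
whose named fact `automorphicInduction_cyclic_cuspidal_unramified` (call it `T`) is Arthur–Clozel's
cuspidal automorphic induction of prime degree (Ch. 3, Thm. 4.2 (e), Thm. 6.2, Lemma 6.4) **with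
the Hecke–Satake relation at every finite place unramified for the data** (Henniart 2012, Thm. 3
with Thm. 5).

## What the sources print (read: Henniart, PDF pp. 3–17; Arthur–Clozel, PDF pp. 181, 183–186)

* G. Henniart, *Induction automorphe globale pour les corps de nombres*, Bull. SMF 140 (2012):
  §1.10 "on dit qu'une représentation automorphe `π` de `GL_{md}(𝔸_F)`, induite de cuspidale
  unitaire, est induite automorphe de `τ` (dans l'extension `E/F`) si les conditions sur les
  facteurs `L` de (1.1) sont satisfaites" — (1.1) is at *almost every* place (§1.1 "pour presque
  toute place `v` de `F`"), "Par rigidité, `π` est alors unique à isomorphisme près" (§2.1: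
  Jacquet–Shalika II, Thm. 4.4; by Langlands [8] the comparison representation need not be induced
  from unitary cuspidal); **Théorème 3** (existence of `τ^{E/F}`, induced from unitary cuspidal,
  base change `τ × τ^σ × ⋯ × τ^{σ^{d-1}}`, `κ`-stable); **Prop. 2.7** (`τ^{E/F}`, `τ` cuspidal
  unitary, is cuspidal iff the stabiliser of `τ` in `Γ` is trivial — §2.6); **Théorème 5** "Soit
  `v` une place finie de `F`. Alors `π_v` est l'induite automorphe (locale) de la représentation
  `τ_v` de `GL_m(E_v)`" (every finite place; §3.7: "conséquence immédiate de la construction …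
  donnée par le théorème 3, et du théorème 6"), and §1.12: local automorphic induction corresponds
  under the Langlands correspondence to induction of Weil–Deligne representations [3, 4, 5] — so
  at a finite `v` unramified in `E` with every `τ_w`, `w ∣ v`, unramified of Satake parameter
  `β_w`, `π_v` is unramified with `∏_{a ∈ t_{π,v}} (X - a) = ∏_{w ∣ v} ∏_{b ∈ β_w} (X^{f(w|v)} - b)`.
* J. Arthur, L. Clozel, Ann. of Math. Stud. 120 (1989), Ch. 3: Def. 6.1 and its reformulation
  (6.1)–(6.2) are "at almost all places" (PDF p. 184); Thm. 6.2 / Lemma 6.4 give the (cuspidal)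
  induced representation with (6.1)–(6.2) almost everywhere — the tree's named fact
  `automorphicInduction_cyclic_cuspidal` (`IsAutomorphicInductionAlong`); Thm. 5.1 (PDF p. 181)
  "(STRONG LIFTING) … If `Π` is a weak lifting of `π`, then `Π` is in fact a strong lifting of `π`"
  is the base-change counterpart of Henniart's Thm. 5.

## What this file proves, and the exact residue of `T`

`T` is, verbatim, the almost-everywhere fact `automorphicInduction_cyclic_cuspidal` with its
conclusion `IsAutomorphicInductionAlong π.1 P.1` (Def. 6.1: the relation at almost every `v`)
upgraded to the relation at **every** finite `v` unramified in `E` above which `π` is unramified.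
Accordingly:

* `T → automorphicInduction_cyclic_cuspidal` is `automorphicInduction_cyclic_cuspidal_of_unramified`
  (in `AutomorphicInductionCuspidalUnramified`: only finitely many places ramify);
* **`automorphicInduction_cyclic_cuspidal_unramified_of_leaves`** (here): `T` follows from
  `automorphicInduction_cyclic_cuspidal` (Arthur–Clozel Thm. 6.2 + Lemma 6.4, almost everywhere)
  together with the datum-model content of **Henniart's Thm. 5 at the unramified places** — for a
  CUSPIDAL `P` on `GL_{n[E:K]}(𝔸_K)` automorphically induced from the cuspidal `π` in the a.e.
  sense (hence `P ≅ π^{E/K}` by rigidity, §2.1), the relation holds at every finite place `v` of `K`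
  unramified in `E` at which all `π_w`, `w ∣ v`, are unramified — taken as the raw hypothesis `h5`
  (exactly as `HarrisLanTaylorThorne2016.theoremA_existence_of_leaves'` carried strong cuspidal base
  change as a raw hypothesis before `ArthurClozel1989_strongLifting_cuspidal` named it).  No named
  fact is introduced for `h5` here (D-0026: a `provefact` seat on `T` may not mint the missing step
  of its own proof); the tree has the base-change analogue of the predicate
  (`IsUnramifiedBaseChangeLift`) and of the leaf (`ArthurClozel1989_strongLifting_cuspidal`, which
  does not apply to `P = AI(π) ≅ P ⊗ η_{E/K}`), but neither local components nor local automorphic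
  induction, so `h5` is not derivable from what is on the tree.

So a discharge `automorphicInduction_cyclic_cuspidal_unramified_holds` is exactly
`automorphicInduction_cyclic_cuspidal_unramified_of_leaves automorphicInduction_cyclic_cuspidal_holds h`
with `h` a proof of the statement `h5` below (Henniart 2012, Thm. 5 with §1.12 and §2.1), once both
exist; `automorphicInduction_cyclic_cuspidal_holds` itself is reduced in
`AutomorphicInductionCuspidalProofs` to `ArthurClozel1989_descent_of_galOrbit` (Thm. 4.2 (e): the
twisted trace formula) and `multiplicity_one_gl`.

## References

* [Henniart2012] G. Henniart, Bull. Soc. Math. France 140 (2012) 1–17, doi:10.24033/bsmf.2622: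
  §1.1, §1.10, §1.12, Thm. 3, Thm. 5, §2.1, §2.6, Prop. 2.7, §3.7.
* [ArthurClozelAMS120] J. Arthur, L. Clozel, Ann. of Math. Stud. 120 (1989), Ch. 3, Thm. 5.1,
  Def. 6.1, (6.1)–(6.2), Thm. 6.2, Lemma 6.4.
-/

noncomputable section

open scoped Classical Polynomial
open NumberField IsDedekindDomain Filter Polynomial

namespace Literature.NumberTheory.Automorphic

/-- **`T` from the almost-everywhere fact and Henniart's Thm. 5 at the unramified places.**
Cyclic automorphic induction of prime degree, cuspidal case, with the Hecke–Satake relation at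
EVERY place unramified for the data (`automorphicInduction_cyclic_cuspidal_unramified`) follows from
(`h62`) Arthur–Clozel's Thm. 6.2 with Lemma 6.4 — a CUSPIDAL `P` on `GL_{n[E:K]}(𝔸_K)`
automorphically induced from `π` in the sense of Def. 6.1, i.e. (6.1)–(6.2) at almost every place
(`automorphicInduction_cyclic_cuspidal`) — and (`h5`) Henniart 2012, Thm. 5 "Soit `v` une place
finie de `F`. Alors `π_v` est l'induite automorphe (locale) de la représentation `τ_v` de
`GL_m(E_v)`", read at the places unramified for `E/K` and `τ` (§1.12: local automorphic induction
is induction of Weil–Deligne parameters, so the local induced representation is unramified with the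
induced Satake polynomial `inducedSatakePolynomial`), for any cuspidal `P` automorphically induced
from `π` almost everywhere (such a `P` is `π^{E/K}` by rigidity, §1.10 and §2.1).  The hypothesis
`h5` is the datum-model statement of that theorem; it is not a named fact of the tree (see the
module docstring). [cite: Henniart2012, Thm. 5 with §1.12, §1.10 and §2.1; Thm. 3] -/
theorem automorphicInduction_cyclic_cuspidal_unramified_of_leaves
    (h62 : automorphicInduction_cyclic_cuspidal)
    (h5 : ∀ (n : ℕ) (K E : Type) [Field K] [NumberField K] [Field E] [NumberField E] [Algebra K E]
      [IsGalois K E], IsCyclic (E ≃ₐ[K] E) → (Module.finrank K E).Prime → 0 < n →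
        ∀ (hE : isCompact_glFiniteIntegralLevel n E)
          (hK : isCompact_glFiniteIntegralLevel (n * Module.finrank K E) K)
          (π : CuspidalAutomorphicRepData n E hE)
          (P : CuspidalAutomorphicRepData (n * Module.finrank K E) K hK),
          IsAutomorphicInductionAlong π.1 P.1 →
            ∀ (v : HeightOneSpectrum (𝓞 K)) (β : HeightOneSpectrum (𝓞 E) → Multiset ℂ),
              Algebra.IsUnramifiedIn (𝓞 E) v.asIdeal →
              (∀ w : HeightOneSpectrum (𝓞 E), w.asIdeal.under (𝓞 K) = v.asIdeal →
                  π.1.HasSatakeParamAt w (β w)) →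
                ∃ α : Multiset ℂ, P.1.HasSatakeParamAt v α ∧
                  satakePolynomial α = inducedSatakePolynomial v β) :
    automorphicInduction_cyclic_cuspidal_unramified := by
  intro n K E _ _ _ _ _ _ hcyc hl hn hE hK π hπ
  obtain ⟨P, hP⟩ := h62 n K E hcyc hl hn hE hK π hπ
  exact ⟨P, fun v β hv hβ ↦ h5 n K E hcyc hl hn hE hK π P hP v β hv hβ⟩

/-- **Conversely, `T` gives both ingredients on its own output**: the cuspidal `P` it provides is
automorphically induced from `π` almost everywhere (Arthur–Clozel Def. 6.1; only finitely many
places of `K` ramify in `E`) AND satisfies the relation at every unramified place — the conjunction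
a consumer such as the crux `HostInducedRep` reads off.
[cite: ArthurClozelAMS120, Ch. 3 Def. 6.1, Thm. 6.2 and Lemma 6.4] -/
theorem automorphicInduction_cyclic_cuspidal_unramified.exists_along_and_forall
    (hT : automorphicInduction_cyclic_cuspidal_unramified) (n : ℕ) (K E : Type) [Field K]
    [NumberField K] [Field E] [NumberField E] [Algebra K E] [IsGalois K E]
    (hcyc : IsCyclic (E ≃ₐ[K] E)) (hl : (Module.finrank K E).Prime) (hn : 0 < n)
    (hE : isCompact_glFiniteIntegralLevel n E)
    (hK : isCompact_glFiniteIntegralLevel (n * Module.finrank K E) K)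
    (π : CuspidalAutomorphicRepData n E hE) (hπ : ¬ IsGaloisStableSatakeAE K π.1) :
    ∃ P : CuspidalAutomorphicRepData (n * Module.finrank K E) K hK,
      IsAutomorphicInductionAlong π.1 P.1 ∧
        ∀ (v : HeightOneSpectrum (𝓞 K)) (β : HeightOneSpectrum (𝓞 E) → Multiset ℂ),
          Algebra.IsUnramifiedIn (𝓞 E) v.asIdeal →
          (∀ w : HeightOneSpectrum (𝓞 E), w.asIdeal.under (𝓞 K) = v.asIdeal →
              π.1.HasSatakeParamAt w (β w)) →
            ∃ α : Multiset ℂ, P.1.HasSatakeParamAt v α ∧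
              satakePolynomial α = inducedSatakePolynomial v β := by
  obtain ⟨P, hP⟩ := hT n K E hcyc hl hn hE hK π hπ
  refine ⟨P, ?_, hP⟩
  have hfin : ∀ᶠ v : HeightOneSpectrum (𝓞 K) in cofinite,
      Algebra.IsUnramifiedIn (𝓞 E) v.asIdeal := by
    filter_upwards [(Literature.NumberTheory.GaloisRepresentations.finite_setOf_not_isUnramifiedIn
      K E).compl_mem_cofinite] with v hv
    simpa using hv
  filter_upwards [hfin] with v hv β hβ
  exact hP v β hv hβ

end Literature.NumberTheory.Automorphic

end
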